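import Literature.NumberTheory.GaloisRepresentations.IdeleBrauerLocalInvariantsDictionary
import Literature.NumberTheory.GaloisRepresentations.IdelePlaceReadout
import HarnessLib

/-!
# The idèle local invariant at a finite place IS the local invariant of the class read out through `π_v`
# (F7-dict (ii): `inv_{w_v}(c) = inv_{K_v}[pull_{(d ↦ d|_E, π_v)} c]` for EVERY `c ∈ H²(Gal(E/F), J_E)`;
# Tate, C–F VII §7.3 Cor. 7.4 (b), §11.2; Serre, *Local Fields* XI §2 Prop. 1)

Topic `NumberTheory/GaloisRepresentations`; namespace `Literature.NumberTheory.GaloisRepresentations.IdeleCohomology`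
(door-c5's idèle local invariants; `IdeleReadout` opened).  Definitions with bodies (two pairs, one `Rep` morphism) and
theorems; NO named fact, no `sorry`, no notation, no global instance — one LOCAL instance attribute
(`attribute [local instance] absoluteGaloisGroup_compactSpace`, the tree's theorem, needed to form continuous
`2`-cocycle classes, exactly as in `IdeleBrauerLocalInvariantsDictionary.lean`; no override); number fields in `Type`.

THE DICTIONARY, GENERAL CLASSES.  Door-c6 g13 proved it for relative Brauer classes
(`localInvAt_brauerToIdele_eq_brauerInvariantEquiv`); door-c6 g16's pairing step (R4) of the presentation road
(FINDING-door-c6-g16 §3, F7-dict (ii), assigned to door-c5) needs it for EVERY idèle class `c ∈ H²(Gal(E/F), J_E)`: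

  `localInvAt w_v c = inv_{F_v} [ (s, t) ↦ π_v (c(s|_E, t|_E)) ]`,

where `π_v = idelePlaceReadout v ιE : J_E → F̄_vˣ` is door-c5 g17's place readout (the `w_v`-component followed by
the distinguished embedding `E_{w_v} → F̄_v`) and `s ↦ s|_E = galRestrict v ιE s`.  Proof.  (1) Door-c5's Shapiro
isomorphism on a general class is `Hⁿ(decompIncl w, pr_w)` (`shapiro_placeProj`, from `groupCohomologyUnitsRepIso_hom_eq`:
`Sh_w = Hⁿ(G_w ↪ G, π_w)`), so `localInvAt w [b] = inv_{F_v}[pull_{P_w} b]` for the pair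
`P_w = (absUnitsPair F_v E_w) ∘ (decompIncl w, pr_w)` whose module component is `x ↦ ι_{E_w}(x_w)`
(`localInvAt_eq_pull`).  (2) At `w = w_v` the two `F_v`-embeddings `ι_{E_w}` (`embeddingToAbs`) and `placeEmb` of the
normal `E_w` differ by `τ = g_w`, `g ∈ G_w` (`exists_stabilizer_placeEmb_eq`), hence the readout pair
`Q = (galRestrict, π_v)` is CONJUGATE to `P_w` by `g` (`galRestrict s = g⁻¹ P_w.f(s) g`, `Q.φ x = P_w.φ (g • x)`), and
conjugate pairs induce the same map on `H²` (`CompatiblePair.twoCocycleClass_pull_eq_of_conj`, Serre VII §5 Prop. 3).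

## What is formalised (`F E : Type`, `[IsGalois F E]`, `v` finite, `w : Place F E v`, `ιE : E →ₐ[F] F̄`)

* `idelePlaceRepHom w : Res_{decompIncl w} J_E ⟶ E_wˣ` (`x ↦ x_w`), **`shapiro_placeProj`** (all degrees),
  `idelePair w`, **`localInvAt_eq_pull`** (`localInvAt w [b] = inv_{F_v}[pull_{idelePair w} b]`).
* `exists_stabilizer_placeEmb_eq` (`placeEmb = ι_{E_{w_v}} ∘ g_{w_v}`, `g ∈ G_{w_v}`), `galRestrict_eq_conj`,
  `isLocallyConstant_galRestrict`, **`readoutPair v ιE`** (the pair `(galRestrict v ιE, π_v)`), `readoutPair_φ`,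
  **`localInvAt_embPlace_eq_readout`**: `localInvAt (embPlace v ιE) [b] = inv_{F_v}[pull_{readoutPair} b]`,
  **`localInv_eq_readout`** (door-c5's `localInv E v`, any chosen place).

## References
* J. W. S. Cassels, A. Fröhlich (eds.), *Algebraic Number Theory* (1967), Ch. VII (Tate) §7.2–§7.3 Cor. 7.4 (b), §11.2.
  [CasselsFrohlichANT1967]
* J.-P. Serre, *Local Fields*, GTM 67 (1979), Ch. VII §5 Prop. 3, Ch. XI §2 Prop. 1. [SerreLocalFields1979]
* J.-P. Serre, *Galois Cohomology* (1997), Ch. I §2.4–2.5. [SerreGaloisCohomology1997]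
-/

noncomputable section

open NumberField IsDedekindDomain CategoryTheory groupCohomology Function Field
open Literature.NumberTheory.Automorphic

namespace Literature.NumberTheory.GaloisRepresentations

namespace IdeleCohomology

open SemiLocal IdeleReadout Literature.Algebra.Homology DiscreteGaloisModule
open Literature.AnabelianGeometry.AbsoluteAnabelian.Prop121vii

-- As in `IdeleBrauerLocalInvariantsDictionary.lean`: the classes `twoCocycleClass` need `LocallyCompactSpace Γ_K`, whose
-- only source for a general field is this theorem; local, no override.
attribute [local instance] absoluteGaloisGroup_compactSpace

variable {F : Type} [Field F] [NumberField F] {E : Type} [Field E] [NumberField E] [Algebra F E] [IsGalois F E]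
variable {v : HeightOneSpectrum (𝓞 F)}

omit [IsGalois F E] in
/-- `F_v` has characteristic `0`. [cite: CasselsFrohlichANT1967, Ch. II §10] -/
private theorem charZero_base' (v : HeightOneSpectrum (𝓞 F)) : CharZero (v.adicCompletion F) :=
  charZero_adicCompletion v

/-! ## §1. Shapiro on a general idèle class: `Sh_w ∘ Hⁿ(π_v) = Hⁿ(decompIncl w, pr_w)` -/

/-- **`J_E → E_wˣ`, `x ↦ x_w`, as a morphism `Res_{decompIncl w} J_E ⟶ E_wˣ`** of `Gal(E_w/F_v)`-modules
(`(g • x)_w = g_w(x_w)` for `g ∈ G_w`). [cite: CasselsFrohlichANT1967, Ch. VII §1.1, §7.2] -/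
def idelePlaceRepHom (w : Place F E v) :
    Rep.res (decompIncl w) (IdeleClassGroup.ideleRep F E) ⟶
      Rep.ofAlgebraAutOnUnits (v.adicCompletion F) ((w : HeightOneSpectrum (𝓞 E)).adicCompletion E) :=
  Rep.ofHom ⟨(unitsProj w) ∘ₗ (placeProj (F := F) (E := E) v).hom.toLinearMap, fun g => by
    apply LinearMap.ext
    intro x
    refine Additive.toMul.injective (Units.ext ?_)
    change ((Additive.toMul (unitsProj w ((placeProj v).hom ((IdeleClassGroup.ideleRep F E).ρ (decompIncl w g) x))) :
        ((w : HeightOneSpectrum (𝓞 E)).adicCompletion E)ˣ) : (w : HeightOneSpectrum (𝓞 E)).adicCompletion E) =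
      g ((Additive.toMul (unitsProj w ((placeProj v).hom x)) : ((w : HeightOneSpectrum (𝓞 E)).adicCompletion E)ˣ) :
        (w : HeightOneSpectrum (𝓞 E)).adicCompletion E)
    rw [Rep.hom_comm_apply, decompIncl, MonoidHom.comp_apply]
    have h1 := unitsProj_ρ_stabilizer v w ((decompMulEquiv w).symm.toMonoidHom g)
      (show Additive (SemiLocal F E v)ˣ from (placeProj v).hom x)
    rw [Subgroup.coe_subtype, h1, val_toMul_localUnitsRep_ρ, ← decompAlgEquiv_apply, ← decompMulEquiv_apply]
    exact congrArg (fun e : ((w : HeightOneSpectrum (𝓞 E)).adicCompletion E) ≃ₐ[v.adicCompletion F] _ => e _)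
      ((decompMulEquiv w).apply_symm_apply g)⟩

/-- Unfolding: `idelePlaceRepHom w x = (π_v x)_w`. [cite: CasselsFrohlichANT1967, Ch. VII §7.2] -/
theorem idelePlaceRepHom_apply (w : Place F E v) (x : Additive (ideleGroup E)) :
    (idelePlaceRepHom w).hom x = unitsProj w ((placeProj (F := F) v).hom x) := rfl

/-- **Door-c5's semi-local Shapiro isomorphism on a general idèle class is `Hⁿ(decompIncl w, x ↦ x_w)`**:
`IsoAut_w ∘ Sh_w ∘ Hⁿ(π_v) = Hⁿ(decompIncl w, idelePlaceRepHom w)` (`Sh_w = Hⁿ(G_w ↪ G, π_w)`).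
[cite: CasselsFrohlichANT1967, Ch. VII §7.2] [cite: Brown1982CohomologyGroups, III (6.2)] -/
theorem shapiro_placeProj (w : Place F E v) (n : ℕ) :
    groupCohomology.map (MonoidHom.id _) (placeProj (E := E) v) n ≫ (groupCohomologyUnitsRepIsoAut w n).hom =
      groupCohomology.map (decompIncl w) (idelePlaceRepHom w) n := by
  rw [groupCohomologyUnitsRepIsoAut, Iso.trans_hom, groupCohomologyUnitsRepIso_hom_eq, groupCohomologyLocalUnitsRepIso,
    groupCohomology.mapIso_hom, ← Category.assoc, ← groupCohomology.map_comp, ← groupCohomology.map_comp]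
  refine map_congr' (MonoidHom.ext fun _ => rfl) _ _ (fun x => ?_) n
  refine Additive.toMul.injective (Units.ext ?_)
  rfl

/-- Element form of `shapiro_placeProj` in degree `2`. [cite: CasselsFrohlichANT1967, Ch. VII §7.2] -/
theorem shapiro_placeProj_apply (w : Place F E v) (c : groupCohomology (IdeleClassGroup.ideleRep F E) 2) :
    (groupCohomologyUnitsRepIsoAut w 2).hom (groupCohomology.map (MonoidHom.id (E ≃ₐ[F] E)) (placeProj v) 2 c) =
      groupCohomology.map (decompIncl w) (idelePlaceRepHom w) 2 c := by
  have h := congrArg (fun T => (ConcreteCategory.hom T) c) (shapiro_placeProj w 2)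
  simpa only [ModuleCat.hom_comp, LinearMap.coe_comp, Function.comp_apply] using h

/-- **The idèle pair at `w`**: `(Γ_{F_v}, F̄_vˣ) → (Gal(E/F), J_E)` through the completion, module component
`x ↦ ι_{E_w}(x_w)` (`ι_{E_w} = embeddingToAbs F_v E_w`). [cite: SerreGaloisCohomology1997, Ch. I §2.4] -/
def idelePair (w : Place F E v) : CompatiblePair (IdeleClassGroup.ideleRep F E) (units (v.adicCompletion F)).toTopRep :=
  haveI := charZero_base' v
  haveI := finiteDimensional_place (K := F) w
  haveI := isGalois_place (F := F) w
  (absUnitsPair (v.adicCompletion F) ((w : HeightOneSpectrum (𝓞 E)).adicCompletion E)).compMap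
    (decompIncl w) (idelePlaceRepHom w)

/-- The module component of `idelePair w`: `x ↦ ι_{E_w}(x_w)`. [cite: SerreGaloisCohomology1997, Ch. I §2.4] -/
theorem idelePair_φ (w : Place F E v) (x : Additive (ideleGroup E)) :
    (idelePair w).φ x =
      (haveI := finiteDimensional_place (K := F) w; UnitsCarrier.ofUnits
        (Units.map (embeddingToAbs (v.adicCompletion F) ((w : HeightOneSpectrum (𝓞 E)).adicCompletion E) :
            (w : HeightOneSpectrum (𝓞 E)).adicCompletion E →* AlgebraicClosure (v.adicCompletion F))
          (Additive.toMul (unitsProj w ((placeProj (F := F) v).hom x))))) := by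
  haveI := charZero_base' v
  haveI := finiteDimensional_place (K := F) w
  haveI := isGalois_place (F := F) w
  change (absUnitsPair (v.adicCompletion F) ((w : HeightOneSpectrum (𝓞 E)).adicCompletion E)).φ
    ((idelePlaceRepHom w).hom x) = _
  rw [idelePlaceRepHom_apply, ← ofMul_toMul (unitsProj w ((placeProj (F := F) v).hom x))]
  exact (absUnitsPair_φ_ofMul _ _ _).trans (congrArg UnitsCarrier.ofUnits (Units.ext rfl))

/-- The group component of `idelePair w` is that of door-c6's `localPair w` (`s ↦ decompIncl w (s|_{E_w})`), so all of
`IdeleLocalPairDecomposition` (conjugacy to `res`, inertia, Frobenius) applies to it. [cite: CasselsFrohlichANT1967, Ch. VII §1.1] -/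
theorem idelePair_f (w : Place F E v) (s : absoluteGaloisGroup (v.adicCompletion F)) :
    (idelePair w).f s = (localPair w).f s := rfl

/-- The group component of `idelePair w` acts on `E ⊆ E_w` as dictated by `ι_{E_w}`: `ι_{E_w}((f s) e) = s • ι_{E_w}(e)`.
[cite: SerreGaloisCohomology1997, Ch. I §2.4] -/
theorem embeddingToAbs_idelePair_f (w : Place F E v) (s : absoluteGaloisGroup (v.adicCompletion F)) (e : E) :
    (haveI := finiteDimensional_place (K := F) w;
      embeddingToAbs (v.adicCompletion F) ((w : HeightOneSpectrum (𝓞 E)).adicCompletion E)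
        (((idelePair w).f s e : E) : (w : HeightOneSpectrum (𝓞 E)).adicCompletion E)) =
      s • (haveI := finiteDimensional_place (K := F) w;
        embeddingToAbs (v.adicCompletion F) ((w : HeightOneSpectrum (𝓞 E)).adicCompletion E)
          (e : (w : HeightOneSpectrum (𝓞 E)).adicCompletion E)) := by
  haveI := charZero_base' v
  haveI := finiteDimensional_place (K := F) w
  haveI := isGalois_place (F := F) w
  change embeddingToAbs (v.adicCompletion F) _ ((decompIncl w ((absUnitsPair (v.adicCompletion F)
    ((w : HeightOneSpectrum (𝓞 E)).adicCompletion E)).f s) e : E) : (w : HeightOneSpectrum (𝓞 E)).adicCompletion E) = _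
  rw [coe_decompIncl_apply]
  exact CompatiblePair.apply_f_apply_eq_smul (v.adicCompletion F) (absUnitsPair (v.adicCompletion F)
    ((w : HeightOneSpectrum (𝓞 E)).adicCompletion E)) _ (absUnitsPair_φ_ofMul _ _) s _

/-- **Door-c5's local invariant of a GENERAL idèle class as `inv_{F_v}` of one pulled-back cocycle**:
`localInvAt w [b] = inv_{F_v}[pull_{idelePair w} b]`. [cite: CasselsFrohlichANT1967, Ch. VII §7.3 Cor. 7.4 (b)]
[cite: SerreLocalFields1979, Ch. XIII §3] -/
theorem localInvAt_eq_pull (w : Place F E v) (b : cocycles₂ (IdeleClassGroup.ideleRep F E)) :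
    localInvAt w (H2π _ b) =
      (haveI := charZero_base' v; brauerInvariantEquiv (v.adicCompletion F)
        (twoCocycleClass (units (v.adicCompletion F)).toTopRep ((idelePair w).pull b))) := by
  haveI := charZero_base' v
  haveI := finiteDimensional_place (K := F) w
  haveI := isGalois_place (F := F) w
  rw [localInvAt_apply, shapiro_placeProj_apply, H2π_comp_map_apply, layerInv_eq_brauerInvariantEquiv_unitsAbsInfTwo,
    unitsAbsInfTwo_H2π, CompatiblePair.pull_mapCocycles₂]
  rfl

/-! ## §2. The readout pair `(s ↦ s|_E, π_v)` at the distinguished place and the dictionary -/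

variable (v) (ιE : E →ₐ[F] AlgebraicClosure F)

/-- **The two `F_v`-embeddings of `E_{w_v}` into `F̄_v` differ by an element of the decomposition group**: there is
`g ∈ G_{w_v}` with `placeEmb y = ι_{E_{w_v}}(g_{w_v} y)` for all `y` (`E_{w_v}/F_v` is normal: `AlgHom.restrictNormal'`;
`G_{w_v} ≃* Gal(E_{w_v}/F_v)`). [cite: SerreLocalFields1979, Ch. VII §5 Prop. 3] [cite: CasselsFrohlichANT1967, Ch. VII §1.1] -/
theorem exists_stabilizer_placeEmb_eq :
    ∃ g : MulAction.stabilizer (E ≃ₐ[F] E) (embPlace v ιE),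
      ∀ y : ((embPlace v ιE : Place F E v) : HeightOneSpectrum (𝓞 E)).adicCompletion E,
        placeEmb v ιE y =
          (haveI := finiteDimensional_place (K := F) (embPlace v ιE);
            embeddingToAbs (v.adicCompletion F) (((embPlace v ιE : Place F E v) : HeightOneSpectrum (𝓞 E)).adicCompletion E)
              (decompAlgEquiv (embPlace v ιE) g y)) := by
  haveI := charZero_base' v
  haveI := finiteDimensional_place (K := F) (embPlace v ιE)
  haveI := isGalois_place (F := F) (embPlace v ιE)
  set L := ((embPlace v ιE : Place F E v) : HeightOneSpectrum (𝓞 E)).adicCompletion E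
  let φ₀ : L →ₐ[v.adicCompletion F] AlgebraicClosure (v.adicCompletion F) := embeddingToAbs (v.adicCompletion F) L
  letI : Algebra L (AlgebraicClosure (v.adicCompletion F)) := φ₀.toRingHom.toAlgebra
  haveI : IsScalarTower (v.adicCompletion F) L (AlgebraicClosure (v.adicCompletion F)) :=
    IsScalarTower.of_algebraMap_eq fun x => (φ₀.commutes x).symm
  let τ : L ≃ₐ[v.adicCompletion F] L := (placeEmb v ιE).restrictNormal' L
  have hτ : ∀ y : L, φ₀ (τ y) = placeEmb v ιE y := fun y => by
    have h := AlgHom.restrictNormal_commutes (placeEmb v ιE) L y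
    rw [Algebra.algebraMap_self, RingHom.id_apply] at h
    exact h
  refine ⟨(decompMulEquiv (embPlace v ιE)).symm τ, fun y => ?_⟩
  rw [← decompMulEquiv_apply, MulEquiv.apply_symm_apply]
  exact (hτ y).symm

/-- The correcting element `g ∈ G_{w_v}` (`placeEmb = ι_{E_{w_v}} ∘ g_{w_v}`). [cite: CasselsFrohlichANT1967, Ch. VII §1.1] -/
def readoutCorr : MulAction.stabilizer (E ≃ₐ[F] E) (embPlace v ιE) :=
  Classical.choose (exists_stabilizer_placeEmb_eq v ιE)

/-- `placeEmb y = ι_{E_{w_v}}(g_{w_v} y)`. [cite: CasselsFrohlichANT1967, Ch. VII §1.1] -/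
theorem placeEmb_eq_embeddingToAbs_readoutCorr (y : ((embPlace v ιE : Place F E v) : HeightOneSpectrum (𝓞 E)).adicCompletion E) :
    placeEmb v ιE y =
      (haveI := finiteDimensional_place (K := F) (embPlace v ιE);
        embeddingToAbs (v.adicCompletion F) (((embPlace v ιE : Place F E v) : HeightOneSpectrum (𝓞 E)).adicCompletion E)
          (decompAlgEquiv (embPlace v ιE) (readoutCorr v ιE) y)) :=
  Classical.choose_spec (exists_stabilizer_placeEmb_eq v ιE) y

/-- **The readout restriction is conjugate to the idèle pair's group component**: `s|_E = g⁻¹ (idelePair w_v).f(s) g`.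
[cite: SerreLocalFields1979, Ch. VII §5 Prop. 3] -/
theorem galRestrict_eq_conj (s : absoluteGaloisGroup (v.adicCompletion F)) :
    galRestrict v ιE s =
      (readoutCorr v ιE : E ≃ₐ[F] E)⁻¹ * (idelePair (embPlace v ιE)).f s * (readoutCorr v ιE : E ≃ₐ[F] E) := by
  haveI := finiteDimensional_place (K := F) (embPlace v ιE)
  -- `g ∘ s|_E = f(s) ∘ g`, read through the injective `ι_{E_w} ∘ (E ⊆ E_w)`
  have h1 : ∀ e' : E, embeddingToAbs (v.adicCompletion F)
      (((embPlace v ιE : Place F E v) : HeightOneSpectrum (𝓞 E)).adicCompletion E)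
        ((((readoutCorr v ιE : E ≃ₐ[F] E) e' : E) :
          ((embPlace v ιE : Place F E v) : HeightOneSpectrum (𝓞 E)).adicCompletion E)) =
      placeEmb v ιE (e' : ((embPlace v ιE : Place F E v) : HeightOneSpectrum (𝓞 E)).adicCompletion E) :=
    fun e' => by rw [placeEmb_eq_embeddingToAbs_readoutCorr, decompAlgEquiv_coe]
  have key : (readoutCorr v ιE : E ≃ₐ[F] E) * galRestrict v ιE s =
      (idelePair (embPlace v ιE)).f s * (readoutCorr v ιE : E ≃ₐ[F] E) := by
    refine AlgEquiv.ext fun e => ?_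
    rw [AlgEquiv.mul_apply, AlgEquiv.mul_apply]
    have hinj : Function.Injective (((embeddingToAbs (v.adicCompletion F)
        (((embPlace v ιE : Place F E v) : HeightOneSpectrum (𝓞 E)).adicCompletion E)) :
          ((embPlace v ιE : Place F E v) : HeightOneSpectrum (𝓞 E)).adicCompletion E →+*
            AlgebraicClosure (v.adicCompletion F)).comp
        (algebraMap E (((embPlace v ιE : Place F E v) : HeightOneSpectrum (𝓞 E)).adicCompletion E))) :=
      RingHom.injective _
    apply hinj
    change embeddingToAbs (v.adicCompletion F) _
        ((((readoutCorr v ιE : E ≃ₐ[F] E) (galRestrict v ιE s e) : E) :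
          ((embPlace v ιE : Place F E v) : HeightOneSpectrum (𝓞 E)).adicCompletion E)) =
      embeddingToAbs (v.adicCompletion F) _
        ((((idelePair (embPlace v ιE)).f s ((readoutCorr v ιE : E ≃ₐ[F] E) e) : E) :
          ((embPlace v ιE : Place F E v) : HeightOneSpectrum (𝓞 E)).adicCompletion E))
    rw [h1, embeddingToAbs_idelePair_f, h1, placeEmb_coe, placeEmb_coe, ιE_galRestrict, absGaloisRestrict_apply_smul]
  rw [mul_assoc, ← key, ← mul_assoc, inv_mul_cancel, one_mul]

/-- `s ↦ s|_E` is locally constant on `Γ_{F_v}` (it is conjugate to the locally constant group component of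
`idelePair w_v`). [cite: SerreGaloisCohomology1997, Ch. I §2.4] -/
theorem isLocallyConstant_galRestrict : IsLocallyConstant (galRestrict v ιE) := by
  have h : (galRestrict v ιE : absoluteGaloisGroup (v.adicCompletion F) → E ≃ₐ[F] E) =
      (fun x => (readoutCorr v ιE : E ≃ₐ[F] E)⁻¹ * x * (readoutCorr v ιE : E ≃ₐ[F] E)) ∘ (idelePair (embPlace v ιE)).f := by
    funext s
    exact galRestrict_eq_conj v ιE s
  rw [h]
  exact (idelePair (embPlace v ιE)).isLocallyConstant_f.comp _

/-- **The readout pair `(Γ_{F_v}, F̄_vˣ) → (Gal(E/F), J_E)`**: group component `s ↦ s|_E = galRestrict v ιE s`, module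
component `π_v = idelePlaceReadout v ιE` (compatible by `idelePlaceReadout_smul`). [cite: SerreGaloisCohomology1997, Ch. I §2.4]
[cite: MilneADT2006, I Lemma 4.13 (proof)] -/
def readoutPair : CompatiblePair (IdeleClassGroup.ideleRep F E) (units (v.adicCompletion F)).toTopRep where
  f := galRestrict v ιE
  isLocallyConstant_f := isLocallyConstant_galRestrict v ιE
  φ := idelePlaceReadout v ιE
  comm s a := by
    obtain ⟨x, rfl⟩ := (Additive.ofMul : ideleGroup E ≃ Additive (ideleGroup E)).surjective a
    exact idelePlaceReadout_smul v ιE s x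

/-- The module component of the readout pair is `π_v`. [cite: MilneADT2006, I Lemma 4.13 (proof)] -/
@[simp] theorem readoutPair_φ (x : Additive (ideleGroup E)) : (readoutPair v ιE).φ x = idelePlaceReadout v ιE x := rfl

/-- The group component of the readout pair is `galRestrict`. [cite: SerreGaloisCohomology1997, Ch. I §2.4] -/
@[simp] theorem readoutPair_f (s : absoluteGaloisGroup (v.adicCompletion F)) : (readoutPair v ιE).f s = galRestrict v ιE s := rfl

/-- **The readout pair is conjugate to the idèle pair at `w_v`: module components** `π_v(x) = (idelePair w_v).φ (g • x)`.
[cite: SerreLocalFields1979, Ch. VII §5 Prop. 3] -/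
theorem readoutPair_φ_eq_idelePair_φ_smul (x : Additive (ideleGroup E)) :
    (readoutPair v ιE).φ x =
      (idelePair (embPlace v ιE)).φ ((IdeleClassGroup.ideleRep F E).ρ (readoutCorr v ιE : E ≃ₐ[F] E) x) := by
  haveI := finiteDimensional_place (K := F) (embPlace v ιE)
  rw [readoutPair_φ, idelePair_φ]
  apply unitsVal_injective
  apply Units.ext
  have h1 := unitsProj_ρ_stabilizer v (embPlace v ιE) (readoutCorr v ιE)
    (show Additive (SemiLocal F E v)ˣ from (placeProj v).hom x)
  rw [unitsVal_ofUnits, Units.coe_map, MonoidHom.coe_coe, Rep.hom_comm_apply, h1, val_toMul_localUnitsRep_ρ,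
    ← decompAlgEquiv_apply, ← placeEmb_eq_embeddingToAbs_readoutCorr]
  rfl

/-- **F7-dict (ii): the idèle local invariant at the distinguished place is the local invariant of the class read out
through `π_v`**: `localInvAt w_v [b] = inv_{F_v}[pull_{(s ↦ s|_E, π_v)} b]` for every `2`-cocycle `b` of `Gal(E/F)` in `J_E`.
[cite: CasselsFrohlichANT1967, Ch. VII §7.3 Cor. 7.4 (b), §11.2] [cite: SerreLocalFields1979, Ch. XI §2 Prop. 1] -/
theorem localInvAt_embPlace_eq_readout (b : cocycles₂ (IdeleClassGroup.ideleRep F E)) :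
    localInvAt (embPlace v ιE) (H2π _ b) =
      (haveI := charZero_base' v; brauerInvariantEquiv (v.adicCompletion F)
        (twoCocycleClass (units (v.adicCompletion F)).toTopRep ((readoutPair v ιE).pull b))) := by
  haveI := charZero_base' v
  rw [localInvAt_eq_pull,
    CompatiblePair.twoCocycleClass_pull_eq_of_conj (idelePair (embPlace v ιE)) (readoutPair v ιE)
      (readoutCorr v ιE : E ≃ₐ[F] E) (fun s => galRestrict_eq_conj v ιE s)
      (fun a => readoutPair_φ_eq_idelePair_φ_smul v ιE a) b]

/-- **The same for door-c5's `localInv E v`** (read at the chosen place; the idèle local invariant does not depend on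
the place above `v`, `localInv_eq_localInvAt`). [cite: CasselsFrohlichANT1967, Ch. VII §7.3 Cor. 7.4 (b)] -/
theorem localInv_eq_readout (b : cocycles₂ (IdeleClassGroup.ideleRep F E)) :
    localInv E v (H2π _ b) =
      (haveI := charZero_base' v; brauerInvariantEquiv (v.adicCompletion F)
        (twoCocycleClass (units (v.adicCompletion F)).toTopRep ((readoutPair v ιE).pull b))) := by
  rw [localInv_eq_localInvAt (embPlace v ιE)]
  exact localInvAt_embPlace_eq_readout v ιE b

end IdeleCohomology

end Literature.NumberTheory.GaloisRepresentations

end
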